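import Summits.HubbardSuperconductivity.HubbardSuperconductivity.Theses.IsoperimetricCascade
import Summits.HubbardSuperconductivity.HubbardSuperconductivity.Theorems.IsoperimetricCascadeFlatAGPNormGrowth
import Literature.MathematicalPhysics.QuantumLattice.ApproximateEigenvectorLemmas
import Literature.MathematicalPhysics.QuantumLattice.DWaveSourceProofs
import Literature.MathematicalPhysics.QuantumLattice.PairFieldPairedVectors

/-!
# Line `SpectatorStableNormGrowth` for crux `OverlapRate` — stmt-HubbardSuperconductivity-11981
(route `IsoperimetricCascade`, rank 3; sub-problem `HubbardSuperconductivity`)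

FORWARD line (generator G1 `next-rung`, unit `fwd-rung-HubbardSuperconductivity-04`, planner
`planner-fwd-rung-HubbardSuperconductivity-04-0`, 2026-08-17). Published as
`Cruxes/OverlapRate/Lines/SpectatorStableNormGrowth.lean` (+ card `.md`, + `_special.lean`).

FORWARD:
* rung_decl: `Summit.HubbardSuperconductivity.HubbardSuperconductivity.Cruxes.OverlapRate.SpectatorStableNormGrowth.SpectatorStableNormGrowth`
  (graded family `SpectatorNormGrowth m`, rung = `∀ m`).
* witness (the FLOOR): `Summit.HubbardSuperconductivity.HubbardSuperconductivity.Theorems.IsoperimetricCascade.flatAGPNormGrowth_proof :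
  Summit.HubbardSuperconductivity.HubbardSuperconductivity.Theses.IsoperimetricCascade.FlatAGPNormGrowth`
  (item stmt-HubbardSuperconductivity-11982, proved), file
  `Summits/HubbardSuperconductivity/HubbardSuperconductivity/Theorems/IsoperimetricCascadeFlatAGPNormGrowth.lean`.
* special_file: `Cruxes/OverlapRate/Lines/SpectatorStableNormGrowth_special.lean`; the literal instance is
  ALSO proved in this file: `SpectatorNormGrowth_zero : SpectatorNormGrowth 0` (a `0`-particle reference
  vector is `χ ∅ • |0⟩`, so the `m = 0` member of the family is the floor up to the scalar `|χ ∅|²`).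
* step: the floor bounds the geminal power of the `d`-wave pair field on the VACUUM,
  `(κL⁴)^n ≤ ‖(Δᴴ)^n |0⟩‖²`; the rung relaxes exactly one hypothesis — the reference vector — from `|0⟩`
  to an ARBITRARY `m`-particle vector `χ` ("spectators"): `(κL⁴)^n ‖χ‖² ≤ ‖(Δᴴ)^n χ‖²`, `κ = κ(δ, r, m)`,
  uniformly in `L` and in `χ`. The floor's proof (Cauchy–Schwarz against ONE paired vector `Φ_S`,
  `norm_sq_pow_conjTranspose_pairField_vacuum_ge`) fails at the first spectator: the pair monomials
  `b†_T χ` on a superposed / partially paired reference are neither orthogonal nor of product norm, so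
  `vacuum_dotProduct_pow_pairField_mulVec_paired` has no analogue. Missing input, NAMED: a lower bound
  on the GRAM OPERATOR of pair insertions — stub `stub_gramLDUFloor` (Gauss/LDU factorisation
  `G(t)ᴴG(t) = K(t)ᴴ · N(t) e^{-Σ_k log(1+t²λ_k) N_k} · K(t)` of the BCS-dressing operator
  `G(t) = Π_k (1 + t w_k b†_k)`, `K(t)` pair-annihilating unipotent) — plus the canonical extraction
  `stub_canonicalExtraction` (Poisson-binomial concentration of the level + operator-norm step-down).
* gap_after: the rung is pure pair-algebra kinematics; what separates it from the crux is the PHYSICS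
  stub `stub_dressedFidelity` (every window ground state has fidelity `≥ e^{-γL²}` with SOME dressed flat
  AGP `(Δᴴ)^n χ`, `χ` a unit `2r`-particle vector) — the crux's own reading "`μ_{K-r}` = sup over unit
  `2r`-particle `χ`", which the rung (and only the rung: the vacuum yardstick of the crux must be compared
  with `‖(Δᴴ)^n χ‖²`) converts into `OverlapRate`. `OverlapRate_of` below is that conversion, proved.
* witness_regime: `m = 0` (no spectators) — the floor; every `m ≥ 2` is outside it (the floor's argument
  provably does not extend: for `χ = b†_q|0⟩ - b†_{q'}|0⟩`-type references the one-configuration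
  Cauchy–Schwarz gives `0`).
* method_family: AGP / geminal-power norms; hard-core-boson pair algebra; BCS product-state Gram
  factorisation; Poisson-binomial concentration.
* ladder_ceiling: capped-at-kinematics (statements about `(Δᴴ)^n` on few-particle references never see
  `H_U`); ceiling_lift = the ground-state fidelity input = `stub_dressedFidelity`, i.e. the parent crux
  `OverlapRate` itself (declared crux 11981 of the parent route).

Stubs (sorries ONLY here): `stub_gramLDUFloor` (L, algebraic heart, new), `stub_canonicalExtraction`
(L, analysis), `stub_dressedFidelity` (XL, physics, load-bearing for the crux). Proved (no sorry):
`SpectatorStableNormGrowth_of` (rung from the two kinematic stubs), `SpectatorNormGrowth_zero` (the floor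
instance, from the seed theorem), `re_star_dotProduct_pow_conjTranspose_pairField_vacuum_le` (Yang-type
ceiling `‖(Δᴴ)^n|0⟩‖² ≤ (c_d² L⁴)^n`, from `norm_pairField_le`), and `OverlapRate_of` (the crux BY NAME from
the three stubs: rung + ceiling turn a dressed fidelity into the vacuum-yardstick overlap rate).

Prior art / evidence (searched 2026-08-17, corpus fts+vec AND galaxy): the FLAT, quasi-spin-`SU(2)`
special case of the rung is Racah's seniority normalisation `‖(S⁺)^r |j^ν ν⟩‖² = r!(Ω-ν)!/(Ω-ν-r)!`
(spectators = seniority `ν`, blocking `Ω ↦ Ω - ν`) [corpus:book:talmi2017-simple-models-complex-nuclei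
p.267–268, eqs. (19.15)–(19.19)]; AGP norms on the bare vacuum are elementary symmetric polynomials of the
squared amplitudes [graph:doi:10.1063/1.1704794 (Coleman 1965, AGP)], and geminal states over a "pair vacuum
containing unpaired particles" are the seniority formalism of quantum chemistry
[corpus:paper:doi-10-1016-bs-aiq-2024-07-002 p.3, p.14]. None of these gives a LOWER bound uniform over an
arbitrary (superposed, partially paired) reference `χ` with NON-degenerate amplitudes `w_k` (no quasi-spin
`SU(2)`): that is `stub_gramLDUFloor`. Galaxy (`--star all`, needles "geminal power|seniority scheme|quasi-spin",
"antisymmetrized geminal"): pdf star saturated (queued > 90 s, ×3), panama 12 off-topic hits — null.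

Disproof used: none relevant — `ledger crux ls stmt-HubbardSuperconductivity-11981` lists only
`Lines/birth.{lean,md}` (no `Disproof.lean`, no `_false_without_`, no `Theorems/OverlapRate/Negative/*`);
`ledger negatives --problem HubbardSuperconductivity` touches none of the stubs (checked 2026-08-17).
Relation to `Lines/birth.lean`: birth cuts the crux by SPIN (reduction × spin bound × spin-resolved
overlap against the vacuum yardstick); this line cuts it by REFERENCE STATE (kinematic spectator rung ×
dressed fidelity); the two are compatible (birth's stub B with a `2r`-particle `χ` is this line's
`stub_dressedFidelity` restricted to `S²`-eigenvectors, once the rung is available).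
-/

-- the mandated namespace repeats `HubbardSuperconductivity` (single-problem summit, D-0017)
set_option linter.dupNamespace false

noncomputable section

namespace Summit.HubbardSuperconductivity.HubbardSuperconductivity.Cruxes.OverlapRate.SpectatorStableNormGrowth

open scoped BigOperators Topology Classical Matrix ComplexConjugate Matrix.Norms.L2Operator
open Matrix Literature.Probability.LatticeModels Literature.MathematicalPhysics.QuantumLattice

/-! ## The rung (graded family in the spectator particle number `m`) -/

/-- **Spectator norm growth with `m` spectator particles.** For every `δ ∈ (0,1)` and `r` there are
`κ > 0` and `L₀` such that for all `L ≥ L₀` and EVERY `m`-particle vector `χ` on the fermionic torus,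
`(κ L⁴)^n ‖χ‖² ≤ ‖(Δ_dᴴ)^n χ‖²`, `n = ⌊(1-δ)L²/2⌋ - r`, `Δ_d = pairField dWaveFormFactor L`.
`m = 0` is `FlatAGPNormGrowth` (the floor) up to the scalar `|χ ∅|²`. -/
def SpectatorNormGrowth (m : ℕ) : Prop :=
  ∀ δ ∈ Set.Ioo (0:ℝ) 1, ∀ r : ℕ, ∃ κ : ℝ, 0 < κ ∧ ∃ L₀ : ℕ, ∀ (L : ℕ) [NeZero L], L₀ ≤ L →
    ∀ χ : Fock (Orb (FermionTorus 2 L)), IsNParticle m χ →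
      let n := ⌊(1 - δ) * (L : ℝ) ^ 2 / 2⌋₊ - r
      let Φ := (pairField dWaveFormFactor L)ᴴ ^ n *ᵥ χ
      (κ * (L : ℝ) ^ 4) ^ n * (star χ ⬝ᵥ χ).re ≤ (star Φ ⬝ᵥ Φ).re

/-- **The rung: spectator-stable norm growth** — `SpectatorNormGrowth m` for every `m`. -/
def SpectatorStableNormGrowth : Prop := ∀ m : ℕ, SpectatorNormGrowth m

/-! ## Stub statements -/

/-- The grand-canonical Gram inequality at dressing parameter `t` for an `m`-particle `χ`:
`N(t) (1 + 32 t²)^{-m} ‖χ‖² ≤ Σ_j t^{2j} ‖(Δ_dᴴ)^j χ‖² / (j!)²`, `N(t) = Π_k (1 + t² w_d(k)²)`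
(`w_d = pairFieldMode dWaveFormFactor L`, `w_d² ≤ 32`; the sum is `‖G(t)χ‖²`, `G(t) = Π_k (1 + t w_d(k) b†_k)`,
and stops by nilpotency at `j ≤ L²`). -/
def GCIneq (L : ℕ) [NeZero L] (m : ℕ) (χ : Fock (Orb (FermionTorus 2 L))) (t : ℝ) : Prop :=
  (∏ k : TorusSite 2 L, (1 + t ^ 2 * pairFieldMode dWaveFormFactor L k ^ 2)) *
      ((1 + 32 * t ^ 2)⁻¹) ^ m * (star χ ⬝ᵥ χ).re ≤
    ∑ j ∈ Finset.range (L ^ 2 + 1), t ^ (2 * j) / ((Nat.factorial j : ℝ) ^ 2) *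
      (star ((pairField dWaveFormFactor L)ᴴ ^ j *ᵥ χ) ⬝ᵥ ((pairField dWaveFormFactor L)ᴴ ^ j *ᵥ χ)).re

/-- **Stub GC — Gram–LDU floor (the algebraic heart; size L; new).** For every side `L`, every `m`,
every `m`-particle `χ` and every `t ≥ 0`, `GCIneq L m χ t`. Mechanism: with `G(t) = Π_k (1 + t w_k b†_k)`
one has `G(t)χ = Σ_j (∓t)^j (Δᴴ)^j χ / j!` with mutually orthogonal terms (particle number `m + 2j`), and
the slot-wise Gauss factorisation `(1 + t w_k b_k)(1 + t w_k b†_k) = K_kᴴ D_k K_k`,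
`K_k = 1 + (t w_k/(1+t²λ_k)) b_k`, `D_k = (1+t²λ_k) θ_k^{N_k}`, `θ_k = (1+t²λ_k)^{-1}`, gives
`G(t)ᴴG(t) = K(t)ᴴ D K(t)` with `K(t) - 1` particle-number LOWERING and `D = N(t) Π_k θ_k^{N_k} ≥
N(t)(1+32t²)^{-m}` on the `m`-particle sector; the `m`-particle component of `K(t)χ` is `χ`. -/
def GramLDUFloor : Prop :=
  ∀ (L : ℕ) [NeZero L] (m : ℕ) (χ : Fock (Orb (FermionTorus 2 L))), IsNParticle m χ →
    ∀ t : ℝ, 0 ≤ t → GCIneq L m χ t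

/-- **Stub CE — canonical extraction (size L).** The family of grand-canonical inequalities
`GCIneq L m χ t`, `t ≥ 0`, forces the CANONICAL level `n = ⌊(1-δ)L²/2⌋ - r` of an `m`-particle `χ`
to grow like the floor: `(κL⁴)^n ‖χ‖² ≤ ‖(Δᴴ)^n χ‖²` for `L ≥ L₀(δ, r, m)`. Mechanism: choose `t` with
Poisson-binomial mean `Σ_k t²λ_k/(1+t²λ_k) = n + Δ`, `Δ ≍ L√(m log L)`; Hoeffding kills the levels
`|j - n - Δ| > Δ` against the level-wise ceiling `‖(Δᴴ)^jχ‖²/(j!)² ≤ poly(L)·e_j(λ)‖χ‖²`; the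
surviving level `j ∈ [n, n+2Δ]` has `‖(Δᴴ)^jχ‖² ≥ (j!)² e_j(λ) e^{-O(m)}‖χ‖²/poly(L)`; step down to `n`
by `‖(Δᴴ)^{i-1}χ‖ ≥ ‖(Δᴴ)^iχ‖/‖Δ‖`, `‖Δ‖ ≤ c_d L²` (loss `e^{-O(L√log L)} = e^{-o(n)}`); lattice count
`exists_card_dWaveGap_ge` at `δ/2` and Stirling as in the floor. -/
def CanonicalExtraction : Prop :=
  ∀ δ ∈ Set.Ioo (0:ℝ) 1, ∀ r m : ℕ, ∃ κ : ℝ, 0 < κ ∧ ∃ L₀ : ℕ, ∀ (L : ℕ) [NeZero L], L₀ ≤ L →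
    ∀ χ : Fock (Orb (FermionTorus 2 L)), IsNParticle m χ →
      (∀ t : ℝ, 0 ≤ t → GCIneq L m χ t) →
        let n := ⌊(1 - δ) * (L : ℝ) ^ 2 / 2⌋₊ - r
        let Φ := (pairField dWaveFormFactor L)ᴴ ^ n *ᵥ χ
        (κ * (L : ℝ) ^ 4) ^ n * (star χ ⬝ᵥ χ).re ≤ (star Φ ⬝ᵥ Φ).re

/-- **Stub DF — dressed fidelity of every window ground state (XL, physics, load-bearing).** For every
`(U, δ) ∈ [2,8] × [1/10, 2/5]` there are `r, γ, L₀` such that for all even `L ≥ L₀` every normalised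
`(2K, S^z = 0)`-sector ground state `ψ` of `hubbardTorus 2 L 1 U` (`K = ⌊(1-δ)L²/2⌋`) admits a UNIT
`2r`-particle spectator vector `χ` whose dressed flat `d`-wave AGP `(Δᴴ)^n χ` (`n = K - r`) has fidelity
at a merely exponential rate with `ψ`: `e^{-γL²} ‖(Δᴴ)^n χ‖² ≤ |⟨(Δᴴ)^n χ, ψ⟩|²`. The crux's reading
"`μ_{K-r}` = sup over unit `2r`-particle `χ` of `|⟨(Δᴴ)^{K-r}χ, ψ⟩|²`" in its natural normalisation. -/
def DressedFidelity : Prop :=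
  ∀ U ∈ Set.Icc (2:ℝ) 8, ∀ δ ∈ Set.Icc (1/10:ℝ) (2/5), ∃ r : ℕ, ∃ γ : ℝ, ∃ L₀ : ℕ,
    ∀ (L : ℕ) [NeZero L], L₀ ≤ L → Even L → ∀ ψ : Fock (Orb (FermionTorus 2 L)), star ψ ⬝ᵥ ψ = 1 →
      IsGroundStateInSector (hubbardTorus 2 L 1 U) (2 * ⌊(1 - δ) * (L : ℝ) ^ 2 / 2⌋₊) 0 ψ →
        let Δ := pairField dWaveFormFactor L
        let n := ⌊(1 - δ) * (L : ℝ) ^ 2 / 2⌋₊ - r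
        ∃ χ : Fock (Orb (FermionTorus 2 L)), IsNParticle (2 * r) χ ∧ star χ ⬝ᵥ χ = 1 ∧
          Real.exp (-(γ * (L : ℝ) ^ 2)) * (star (Δᴴ ^ n *ᵥ χ) ⬝ᵥ (Δᴴ ^ n *ᵥ χ)).re ≤
            ‖star (Δᴴ ^ n *ᵥ χ) ⬝ᵥ ψ‖ ^ 2

/-! ## Registered stubs -/

/-- stub GC: the Gram–LDU floor (open; algebraic). -/
theorem stub_gramLDUFloor : GramLDUFloor := by
  sorry

/-- stub CE: canonical extraction (open; analytic). -/
theorem stub_canonicalExtraction : CanonicalExtraction := by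
  sorry

/-- stub DF: dressed fidelity of every window ground state (hardest stub; open; physics). -/
theorem stub_dressedFidelity : DressedFidelity := by
  sorry

/-! ## Name-keyed aliases of the stub statements — the hypotheses of the compositions -/
namespace __Registered

/-- Alias of `GramLDUFloor` keyed by the registered stub name. -/
abbrev stub_gramLDUFloor : Prop := GramLDUFloor
/-- Alias of `CanonicalExtraction` keyed by the registered stub name. -/
abbrev stub_canonicalExtraction : Prop := CanonicalExtraction
/-- Alias of `DressedFidelity` keyed by the registered stub name. -/
abbrev stub_dressedFidelity : Prop := DressedFidelity

end __Registered

/-! ## Composition 1: the rung from the two kinematic stubs (no `sorry`) -/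

/-- **SpectatorStableNormGrowth_of** — GC gives the grand-canonical inequalities for every `t ≥ 0`,
CE extracts the canonical level. -/
theorem SpectatorStableNormGrowth_of (hGC : __Registered.stub_gramLDUFloor)
    (hCE : __Registered.stub_canonicalExtraction) : SpectatorStableNormGrowth := by
  dsimp only [__Registered.stub_gramLDUFloor, GramLDUFloor] at hGC
  dsimp only [__Registered.stub_canonicalExtraction, CanonicalExtraction] at hCE
  intro m δ hδ r
  obtain ⟨κ, hκ, L₀, h⟩ := hCE δ hδ r m
  refine ⟨κ, hκ, L₀, ?_⟩
  intro L _ hL χ hχ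
  exact h L hL χ hχ (fun t ht => hGC L m χ hχ t ht)

/-! ## The floor instance `m = 0` (F3 witness, no `sorry`) -/

/-- **The floor is the `m = 0` member of the family**: a `0`-particle vector is `χ ∅ • |0⟩`, so
`FlatAGPNormGrowth` (seed theorem `flatAGPNormGrowth_proof`) gives `SpectatorNormGrowth 0` with the same
`κ, L₀`. -/
theorem SpectatorNormGrowth_zero : SpectatorNormGrowth 0 := by
  intro δ hδ r
  obtain ⟨κ, hκ, L₀, h⟩ :=
    Summit.HubbardSuperconductivity.HubbardSuperconductivity.Theorems.IsoperimetricCascade.flatAGPNormGrowth_proof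
      δ hδ r
  refine ⟨κ, hκ, L₀, ?_⟩
  intro L _ hL χ hχ
  have hfloor := h L hL
  simp only at hfloor ⊢
  -- a `0`-particle vector is a multiple of the vacuum
  have hχeq : χ = χ ∅ • (vacuum : Fock (Orb (FermionTorus 2 L))) := by
    funext s
    by_cases hs : s = ∅
    · subst hs; simp [vacuum]
    · have h0 : χ s = 0 := hχ s (fun h => hs (Finset.card_eq_zero.1 h))
      simp [vacuum, hs, h0]
  set a : ℂ := χ ∅ with ha
  set n : ℕ := ⌊(1 - δ) * (L : ℝ) ^ 2 / 2⌋₊ - r with hn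
  set Φ₀ := (pairField dWaveFormFactor L)ᴴ ^ n *ᵥ (vacuum : Fock (Orb (FermionTorus 2 L))) with hΦ₀
  have hΦ : (pairField dWaveFormFactor L)ᴴ ^ n *ᵥ χ = a • Φ₀ := by
    rw [hχeq, mulVec_smul]
  have hnormχ : (star χ ⬝ᵥ χ).re = ‖a‖ ^ 2 := by
    rw [hχeq, star_smul, smul_dotProduct, dotProduct_smul, star_vacuum_dotProduct_vacuum]
    simp only [smul_eq_mul, mul_one, Complex.star_def]
    rw [Complex.conj_mul', ← Complex.ofReal_pow, Complex.ofReal_re]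
  have hnormΦ : (star (a • Φ₀) ⬝ᵥ (a • Φ₀)).re = ‖a‖ ^ 2 * (star Φ₀ ⬝ᵥ Φ₀).re := by
    rw [star_smul, smul_dotProduct, dotProduct_smul, smul_smul]
    simp only [smul_eq_mul, Complex.star_def]
    rw [Complex.conj_mul', ← Complex.ofReal_pow, Complex.re_ofReal_mul]
  rw [hΦ, hnormχ, hnormΦ, mul_comm]
  exact mul_le_mul_of_nonneg_left hfloor (sq_nonneg _)

/-! ## The Yang-type ceiling (proved): `‖(Δᴴ)^n |0⟩‖² ≤ (c_d² L⁴)^n` -/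

/-- `‖A^k v‖₂ ≤ ‖A‖^k ‖v‖₂` (operator norm, induction). [folklore] -/
theorem eucNorm_pow_mulVec_le {ι : Type*} [Fintype ι] [DecidableEq ι] (A : Matrix ι ι ℂ) (v : ι → ℂ) :
    ∀ k : ℕ, eucNorm (A ^ k *ᵥ v) ≤ ‖A‖ ^ k * eucNorm v
  | 0 => by simp only [pow_zero, one_mulVec, one_mul, le_refl]
  | k + 1 => by
      calc eucNorm (A ^ (k + 1) *ᵥ v) = eucNorm (A *ᵥ (A ^ k *ᵥ v)) := by
            rw [pow_succ', Matrix.mulVec_mulVec]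
        _ ≤ ‖A‖ * eucNorm (A ^ k *ᵥ v) := eucNorm_mulVec_le _ _
        _ ≤ ‖A‖ * (‖A‖ ^ k * eucNorm v) :=
            mul_le_mul_of_nonneg_left (eucNorm_pow_mulVec_le A v k) (norm_nonneg _)
        _ = ‖A‖ ^ (k + 1) * eucNorm v := by ring

/-- The `d`-wave a-priori constant `c_d = 2 Σ_{e ∈ {0,±e₁,±e₂}} |g_d(e)/√2|` of `norm_pairField_le`. -/
def cD : ℝ := 2 * ∑ e ∈ insert (0 : Site 2) unitSteps, |dWaveFormFactor e / Real.sqrt 2|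

/-- **Yang-type ceiling**: `‖(Δ_dᴴ)^n |0⟩‖² ≤ (c_d² L⁴)^n` (from `‖Δ_d‖ ≤ c_d L²`, `norm_pairField_le`). -/
theorem re_star_dotProduct_pow_conjTranspose_pairField_vacuum_le (L : ℕ) [NeZero L] (n : ℕ) :
    (star ((pairField dWaveFormFactor L)ᴴ ^ n *ᵥ (vacuum : Fock (Orb (FermionTorus 2 L)))) ⬝ᵥ
        ((pairField dWaveFormFactor L)ᴴ ^ n *ᵥ (vacuum : Fock (Orb (FermionTorus 2 L))))).re ≤
      (cD ^ 2 * (L : ℝ) ^ 4) ^ n := by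
  have hvac : eucNorm (vacuum : Fock (Orb (FermionTorus 2 L))) = 1 :=
    eucNorm_eq_one star_vacuum_dotProduct_vacuum
  have hop : ‖(pairField dWaveFormFactor L)ᴴ‖ ≤ cD * (L : ℝ) ^ 2 := by
    rw [Matrix.l2_opNorm_conjTranspose]
    exact norm_pairField_le dWaveFormFactor L
  have h1 : eucNorm ((pairField dWaveFormFactor L)ᴴ ^ n *ᵥ (vacuum : Fock (Orb (FermionTorus 2 L)))) ≤
      (cD * (L : ℝ) ^ 2) ^ n := by
    calc eucNorm ((pairField dWaveFormFactor L)ᴴ ^ n *ᵥ (vacuum : Fock (Orb (FermionTorus 2 L))))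
        ≤ ‖(pairField dWaveFormFactor L)ᴴ‖ ^ n * eucNorm (vacuum : Fock (Orb (FermionTorus 2 L))) :=
          eucNorm_pow_mulVec_le _ _ n
      _ = ‖(pairField dWaveFormFactor L)ᴴ‖ ^ n := by rw [hvac, mul_one]
      _ ≤ (cD * (L : ℝ) ^ 2) ^ n := pow_le_pow_left₀ (norm_nonneg _) hop n
  rw [← eucNorm_sq]
  calc eucNorm ((pairField dWaveFormFactor L)ᴴ ^ n *ᵥ (vacuum : Fock (Orb (FermionTorus 2 L)))) ^ 2
      ≤ ((cD * (L : ℝ) ^ 2) ^ n) ^ 2 := pow_le_pow_left₀ (eucNorm_nonneg _) h1 2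
    _ = (cD ^ 2 * (L : ℝ) ^ 4) ^ n := by ring

/-! ## Composition 2: the crux BY NAME from the three stubs (no `sorry`) -/

/-- **OverlapRate_of** — dressed fidelity (DF) gives, for every window ground state `ψ`, a unit
`2r`-particle `χ` with `e^{-γL²} ‖(Δᴴ)^nχ‖² ≤ |⟨(Δᴴ)^nχ, ψ⟩|² ≤ ‖Δ^nψ‖²` (Cauchy–Schwarz); the rung
(from GC + CE) gives `(κL⁴)^n ≤ ‖(Δᴴ)^nχ‖²`, the ceiling gives `‖(Δᴴ)^n|0⟩‖² ≤ (c_d²L⁴)^n ≤ M^n (κL⁴)^n`,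
`M = max 1 (c_d²/κ)`, and `M^n ≤ M^{L²/2}` (`n ≤ L²/2`) is absorbed into `γ' = γ + (log M)/2`. -/
theorem OverlapRate_of (hGC : __Registered.stub_gramLDUFloor)
    (hCE : __Registered.stub_canonicalExtraction) (hF : __Registered.stub_dressedFidelity) :
    Summit.HubbardSuperconductivity.HubbardSuperconductivity.Theses.IsoperimetricCascade.OverlapRate := by
  have hK : SpectatorStableNormGrowth := SpectatorStableNormGrowth_of hGC hCE
  dsimp only [SpectatorStableNormGrowth, SpectatorNormGrowth] at hK
  dsimp only [__Registered.stub_dressedFidelity, DressedFidelity] at hF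
  dsimp only [Summit.HubbardSuperconductivity.HubbardSuperconductivity.Theses.IsoperimetricCascade.OverlapRate]
  intro U hU δ hδ
  obtain ⟨r, γ, L₁, hF'⟩ := hF U hU δ hδ
  have hδ' : δ ∈ Set.Ioo (0:ℝ) 1 := ⟨by linarith [hδ.1], by linarith [hδ.2]⟩
  obtain ⟨κ, hκ, L₂, hK'⟩ := hK (2 * r) δ hδ' r
  -- constants
  set M : ℝ := max 1 (cD ^ 2 / κ) with hM
  have hM1 : 1 ≤ M := le_max_left _ _
  have hM0 : 0 < M := lt_of_lt_of_le one_pos hM1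
  have hlogM : 0 ≤ Real.log M := Real.log_nonneg hM1
  have hcM : cD ^ 2 ≤ M * κ := by
    have h : cD ^ 2 / κ ≤ M := le_max_right _ _
    rwa [div_le_iff₀ hκ] at h
  refine ⟨r, γ + Real.log M / 2, max L₁ L₂, ?_⟩
  intro L _ hL hEv ψ hψ1 hGS
  obtain ⟨χ, hχN, hχ1, hfid⟩ := hF' L (le_of_max_le_left hL) hEv ψ hψ1 hGS
  have hrung := hK' L (le_of_max_le_right hL) χ hχN
  -- names
  set Δ := pairField dWaveFormFactor L with hΔ
  set n : ℕ := ⌊(1 - δ) * (L : ℝ) ^ 2 / 2⌋₊ - r with hn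
  set A : ℝ := (star (Δᴴ ^ n *ᵥ χ) ⬝ᵥ (Δᴴ ^ n *ᵥ χ)).re with hA
  set V : ℝ := (star (Δᴴ ^ n *ᵥ (vacuum : Fock (Orb (FermionTorus 2 L)))) ⬝ᵥ
    (Δᴴ ^ n *ᵥ (vacuum : Fock (Orb (FermionTorus 2 L))))).re with hV
  set B : ℝ := (star (Δ ^ n *ᵥ ψ) ⬝ᵥ (Δ ^ n *ᵥ ψ)).re with hB
  -- (1) rung with `‖χ‖ = 1`
  have hχre : (star χ ⬝ᵥ χ).re = 1 := by rw [hχ1, Complex.one_re]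
  have h1 : (κ * (L : ℝ) ^ 4) ^ n ≤ A := by simpa [hχre] using hrung
  -- (2) fidelity + Cauchy–Schwarz
  have hmove : star (Δᴴ ^ n *ᵥ χ) ⬝ᵥ ψ = star χ ⬝ᵥ (Δ ^ n *ᵥ ψ) := by
    rw [star_mulVec, ← dotProduct_mulVec, conjTranspose_pow, conjTranspose_conjTranspose]
  have hCS := norm_star_dotProduct_le_eucNorm hχ1 (Δ ^ n *ᵥ ψ)
  have h2 : Real.exp (-(γ * (L : ℝ) ^ 2)) * A ≤ B := by
    calc Real.exp (-(γ * (L : ℝ) ^ 2)) * A ≤ ‖star (Δᴴ ^ n *ᵥ χ) ⬝ᵥ ψ‖ ^ 2 := hfid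
      _ = ‖star χ ⬝ᵥ (Δ ^ n *ᵥ ψ)‖ ^ 2 := by rw [hmove]
      _ ≤ eucNorm (Δ ^ n *ᵥ ψ) ^ 2 := pow_le_pow_left₀ (norm_nonneg _) hCS 2
      _ = B := eucNorm_sq _
  -- (3) ceiling
  have h3 : V ≤ (cD ^ 2 * (L : ℝ) ^ 4) ^ n :=
    re_star_dotProduct_pow_conjTranspose_pairField_vacuum_le L n
  -- (4) arithmetic
  have hL4 : 0 ≤ (L : ℝ) ^ 4 := by positivity
  have hκL : 0 ≤ κ * (L : ℝ) ^ 4 := mul_nonneg hκ.le hL4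
  have h4 : (cD ^ 2 * (L : ℝ) ^ 4) ^ n ≤ M ^ n * (κ * (L : ℝ) ^ 4) ^ n := by
    rw [← mul_pow]
    refine pow_le_pow_left₀ (mul_nonneg (sq_nonneg _) hL4) ?_ n
    calc cD ^ 2 * (L : ℝ) ^ 4 ≤ (M * κ) * (L : ℝ) ^ 4 := mul_le_mul_of_nonneg_right hcM hL4
      _ = M * (κ * (L : ℝ) ^ 4) := by ring
  have hA0 : 0 ≤ A := le_trans (pow_nonneg hκL n) h1
  have hnle : (n : ℝ) ≤ (L : ℝ) ^ 2 / 2 := by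
    have hfl : (⌊(1 - δ) * (L : ℝ) ^ 2 / 2⌋₊ : ℝ) ≤ (1 - δ) * (L : ℝ) ^ 2 / 2 :=
      Nat.floor_le (by nlinarith [sq_nonneg (L : ℝ), hδ'.2])
    have hsub : (n : ℝ) ≤ (⌊(1 - δ) * (L : ℝ) ^ 2 / 2⌋₊ : ℝ) := by
      rw [hn]; exact_mod_cast Nat.sub_le _ _
    nlinarith [sq_nonneg (L : ℝ), hδ'.1]
  have hMn : Real.exp (-(Real.log M / 2 * (L : ℝ) ^ 2)) * M ^ n ≤ 1 := by
    rw [← Real.exp_log hM0, ← Real.exp_nat_mul, Real.exp_log hM0, ← Real.exp_add]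
    rw [Real.exp_le_one_iff]
    nlinarith [hlogM, hnle]
  have hexp : Real.exp (-((γ + Real.log M / 2) * (L : ℝ) ^ 2)) =
      Real.exp (-(γ * (L : ℝ) ^ 2)) * Real.exp (-(Real.log M / 2 * (L : ℝ) ^ 2)) := by
    rw [← Real.exp_add]; congr 1; ring
  have hE0 : 0 ≤ Real.exp (-(γ * (L : ℝ) ^ 2)) := (Real.exp_pos _).le
  have hE1 : 0 ≤ Real.exp (-(Real.log M / 2 * (L : ℝ) ^ 2)) := (Real.exp_pos _).le
  have hV0 : 0 ≤ V := by rw [hV, ← eucNorm_sq]; exact sq_nonneg _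
  calc Real.exp (-((γ + Real.log M / 2) * (L : ℝ) ^ 2)) * V
      = Real.exp (-(γ * (L : ℝ) ^ 2)) * (Real.exp (-(Real.log M / 2 * (L : ℝ) ^ 2)) * V) := by
        rw [hexp, mul_assoc]
    _ ≤ Real.exp (-(γ * (L : ℝ) ^ 2)) *
          (Real.exp (-(Real.log M / 2 * (L : ℝ) ^ 2)) * (M ^ n * A)) := by
        refine mul_le_mul_of_nonneg_left (mul_le_mul_of_nonneg_left ?_ hE1) hE0
        exact h3.trans (h4.trans (mul_le_mul_of_nonneg_left h1 (pow_nonneg hM0.le n)))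
    _ = Real.exp (-(γ * (L : ℝ) ^ 2)) * A * (Real.exp (-(Real.log M / 2 * (L : ℝ) ^ 2)) * M ^ n) := by
        ring
    _ ≤ Real.exp (-(γ * (L : ℝ) ^ 2)) * A * 1 :=
        mul_le_mul_of_nonneg_left hMn (mul_nonneg hE0 hA0)
    _ = Real.exp (-(γ * (L : ℝ) ^ 2)) * A := mul_one _
    _ ≤ B := h2

end Summit.HubbardSuperconductivity.HubbardSuperconductivity.Cruxes.OverlapRate.SpectatorStableNormGrowth
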